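import Summits.ResolutionOfSingularities.ResolutionOfSingularities.Theorems.FrobeniusLadderFRationalResolutionPointBlowupEtale
import Summits.ResolutionOfSingularities.ResolutionOfSingularities.Theorems.FrobeniusLadderFRationalResolutionIsolatedClosed
import Summits.ResolutionOfSingularities.ResolutionOfSingularities.Theorems.FrobeniusLadderFRationalResolutionBlowupRegularFlatChart
import Summits.ResolutionOfSingularities.ResolutionOfSingularities.Theorems.FrobeniusLadderFRationalResolutionBlowupOrbitCentre
import Summits.ResolutionOfSingularities.ResolutionOfSingularities.Theorems.FrobeniusLadderFRationalResolutionPointBlowupOfCompletion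
import Mathlib.AlgebraicGeometry.Morphisms.Etale
import Mathlib.RingTheory.Unramified.LocalRing
import HarnessLib

/-!
# Crux `FrobeniusLadder.FRationalResolution` (stmt-ResolutionOfSingularities-15317), line `redirect`,
# stub `stub_diagonalizableQuotientResolution` — `hloc` from an étale chart whose stalk has a regular blow-up of a POWER of its maximal
# ideal (the `𝔪^{a+1}`-centre form of `…EtaleChartStalkBlowup`, p840894)

Same extraction and flat descent as `…EtaleChartStalkBlowup.hloc_of_etale_chart_stalkBlowup`, for the centre `𝔪^{a+1}` of the stalk
(`𝔭^{a+1} Γ(Y,V)_𝔔 = 𝔪^{a+1}` by unramifiedness; descent `…BlowupRegularFlatChart.isRegular_affineBlowup_of_flat_chart` with `I = 𝔭^{a+1}`;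
conclusion by `…ChartHloc.hloc_of_flat_chart` with the trivial chart). This is the no-Galois counterpart of
`…MaximalIdealTower.hloc_of_isRegular_affineBlowup_maximalIdealPow`.

* ★ `hloc_of_etale_chart_stalkBlowup_pow` — `X` integral, locally of finite type over a field, `Sing X` finite, `φ : Y → X` étale,
  `x = φ y` singular, `Bl_{𝔪^{a+1}}(Spec 𝒪_{Y,y})` regular ⇒ `hloc` at `x`.
* `hasResolution_of_isolated_etale_stalkBlowup_pow`.

Honest label: plumbing toward ONE leaf stub (no stub, crux or summit closed). No definitions, no named facts, no sorry.
[folklore; cite: Kollar2007, §2.2] [cite: Matsumura1987, Thm. 23.7]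
-/
noncomputable section

-- single-problem summit: the doubled namespace component is forced
set_option linter.dupNamespace false

open CategoryTheory AlgebraicGeometry TopologicalSpace
open Literature.AlgebraicGeometry.Resolution

namespace Summit.ResolutionOfSingularities.ResolutionOfSingularities.Theorems.FRationalResolution.EtaleChartStalkBlowupPow

/-- ★ **`hloc` at an isolated singular point from an étale chart whose stalk has `Bl_{𝔪^{a+1}}` regular.** [cite: Kollar2007, §2.2]
[cite: Matsumura1987, Thm. 23.7] -/
theorem hloc_of_etale_chart_stalkBlowup_pow (k : Type) [Field k] (X : Scheme.{0}) [IsIntegral X]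
    (f : X ⟶ Spec (.of k)) [LocallyOfFiniteType f] (hfin : (Scheme.regularLocus X)ᶜ.Finite)
    {Y : Scheme.{0}} (φ : Y ⟶ X) [Etale φ] (y : Y) (hx : φ y ∉ Scheme.regularLocus X)
    (a : ℕ) (hbl : Scheme.IsRegular (affineBlowup ((IsLocalRing.maximalIdeal (Y.presheaf.stalk y)) ^ (a + 1)))) :
    ∃ (W : X.Opens), φ y ∈ W ∧ (∀ t : X, t ∉ Scheme.regularLocus X → t ∈ W → t = φ y) ∧
      ∃ (Z : Scheme.{0}) (ρ : Z ⟶ W), IsProper ρ ∧ Scheme.IsRegular Z ∧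
        IsIso (ρ ∣_ (W.ι ⁻¹ᵁ ⟨Scheme.regularLocus X, isOpen_regularLocus_of_locallyOfFiniteType_field f⟩)) ∧
        Dense ((ρ ⁻¹ᵁ (W.ι ⁻¹ᵁ ⟨Scheme.regularLocus X,
          isOpen_regularLocus_of_locallyOfFiniteType_field f⟩) : Z.Opens) : Set Z) := by
  classical
  set x := φ y with hxdef
  -- (1) the other singular points form a finite set of closed points; remove them
  set T : Set X := (Scheme.regularLocus X)ᶜ \ {x} with hT
  have hTfin : T.Finite := hfin.subset Set.sdiff_subset
  have hTclosed : IsClosed T := by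
    have : T = ⋃ z ∈ T, {z} := (Set.biUnion_of_singleton T).symm
    rw [this]
    exact hTfin.isClosed_biUnion fun z hz =>
      IsolatedClosed.isClosed_singleton_of_finite_singularLocus k X f hfin hz.1
  let W₀ : X.Opens := ⟨Tᶜ, hTclosed.isOpen_compl⟩
  have hxW₀ : x ∈ W₀ := fun h => h.2 rfl
  -- (2) an affine open `U ∋ x` inside `W₀`
  obtain ⟨U, hU, hxU, hUW⟩ := exists_isAffineOpen_mem_and_subset (U := W₀) hxW₀
  haveI : Nonempty U := ⟨⟨x, hxU⟩⟩
  set ι := hU.fromSpec with hιdef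
  set 𝔭 := hU.primeIdealOf ⟨x, hxU⟩ with h𝔭def
  have hι𝔭 : ι 𝔭 = x := hU.fromSpec_primeIdealOf ⟨x, hxU⟩
  have hxcl : IsClosed ({x} : Set X) := IsolatedClosed.isClosed_singleton_of_finite_singularLocus k X f hfin hx
  haveI h𝔭max : 𝔭.asIdeal.IsMaximal := hU.primeIdealOf_isMaximal_of_isClosed ⟨x, hxU⟩ hxcl
  -- points of `Spec Γ(X,U)` other than `𝔭` are regular
  have hregB : ∀ P : Spec Γ(X, U), P.asIdeal ≠ 𝔭.asIdeal → P ∈ Scheme.regularLocus (Spec Γ(X, U)) := by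
    intro P hP
    rw [mem_regularLocus_iff_of_flat_of_isPreimmersion ι]
    have hPU : ι P ∈ U := by
      have : ι P ∈ Set.range ι := ⟨P, rfl⟩
      rwa [hιdef, hU.range_fromSpec] at this
    have hPx : ι P ≠ x := by
      intro h
      apply hP
      have : P = 𝔭 := ι.isOpenEmbedding.injective (h.trans hι𝔭.symm)
      rw [this]
    by_contra hnreg
    exact hUW hPU ⟨hnreg, hPx⟩
  -- `𝔭 ≠ 0`: otherwise `Spec Γ(X,U) = {𝔭}` and the dense regular locus would contain `x`
  have h𝔭0 : 𝔭.asIdeal ≠ ⊥ := by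
    intro h0
    have hbot : (⊥ : Ideal Γ(X, U)).IsMaximal := h0 ▸ h𝔭max
    obtain ⟨t, htU, htreg⟩ := (Scheme.dense_regularLocus X).inter_open_nonempty U U.2 ⟨x, hxU⟩
    have htr : t ∈ Set.range ι := by rw [hιdef, hU.range_fromSpec]; exact htU
    obtain ⟨P, rfl⟩ := htr
    have hP : P.asIdeal = 𝔭.asIdeal := by
      rw [h0]
      exact (hbot.eq_of_le P.isPrime.ne_top bot_le).symm
    have hP' : P = 𝔭 := PrimeSpectrum.ext hP
    rw [hP', hι𝔭] at htreg
    exact hx htreg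
  -- (3) the `k`-algebra structure of `Γ(X,U)`
  obtain ⟨gk, hgk⟩ := Spec.map_surjective (ι ≫ f)
  letI : Algebra k Γ(X, U) := gk.hom.toAlgebra
  have hιf : ι ≫ f = Spec.map (CommRingCat.ofHom (algebraMap k Γ(X, U))) := by
    rw [← hgk]; rfl
  haveI : Algebra.FiniteType k Γ(X, U) := by
    have h1 : LocallyOfFiniteType (Spec.map gk) := by rw [hgk]; infer_instance
    rw [HasRingHomProperty.Spec_iff (P := @LocallyOfFiniteType)] at h1
    exact h1
  -- (4) the chart ring: an affine open `V ∋ y` over `U`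
  have hyU : y ∈ φ ⁻¹ᵁ U := hxU
  obtain ⟨V, hV, hyV, hVU⟩ := exists_isAffineOpen_mem_and_subset (U := φ ⁻¹ᵁ U) hyU
  have e : V ≤ φ ⁻¹ᵁ U := hVU
  set ψ := φ.appLE U V e with hψdef
  have hψ : ψ.hom.Etale := φ.etale_appLE hU hV e
  letI : Algebra Γ(X, U) Γ(Y, V) := ψ.hom.toAlgebra
  haveI : Algebra.Etale Γ(X, U) Γ(Y, V) := hψ
  set 𝔔 := hV.primeIdealOf ⟨y, hyV⟩ with h𝔔def
  have hcomap : 𝔔.asIdeal.comap (algebraMap Γ(X, U) Γ(Y, V)) = 𝔭.asIdeal := by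
    have h := hU.comap_primeIdealOf_appLE (f := φ) U V hV e hyV
    exact congrArg PrimeSpectrum.asIdeal h
  haveI : 𝔔.asIdeal.LiesOver 𝔭.asIdeal := ⟨hcomap.symm⟩
  have hover : 𝔭.asIdeal ≤ 𝔔.asIdeal.comap (algebraMap Γ(X, U) Γ(Y, V)) := hcomap.ge
  -- unramified at `𝔔`
  have hunr : 𝔭.asIdeal.map (algebraMap Γ(X, U) (Localization.AtPrime 𝔔.asIdeal)) =
      IsLocalRing.maximalIdeal (Localization.AtPrime 𝔔.asIdeal) := by
    letI := Localization.AtPrime.algebraOfLiesOver 𝔭.asIdeal 𝔔.asIdeal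
    haveI : Algebra.IsUnramifiedAt Γ(X, U) 𝔔.asIdeal :=
      (Algebra.formallyUnramified_iff_forall).mp inferInstance 𝔔
    exact ((Algebra.isUnramifiedAt_iff_map_eq Γ(X, U) 𝔭.asIdeal 𝔔.asIdeal).mp inferInstance).2
  -- (5) the stalk is the localization of the chart ring at `𝔔`: move `hbl` to `Γ(Y, V)_𝔔`
  letI := Y.presheaf.algebra_section_stalk (⟨y, hyV⟩ : V)
  haveI := hV.isLocalization_stalk ⟨y, hyV⟩
  let e : Localization.AtPrime 𝔔.asIdeal ≃ₐ[Γ(Y, V)] Y.presheaf.stalk y :=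
    IsLocalization.algEquiv 𝔔.asIdeal.primeCompl _ _
  have hC : Scheme.IsRegular (affineBlowup ((IsLocalRing.maximalIdeal (Localization.AtPrime 𝔔.asIdeal)) ^ (a + 1))) := by
    have h := BlowupOrbitCentre.isRegular_affineBlowup_map_of_ringEquiv e.symm.toRingEquiv _ hbl
    rwa [Ideal.map_pow, PointBlowupOfCompletion.map_maximalIdeal_ringEquiv e.symm.toRingEquiv] at h
  rw [← hunr, ← Ideal.map_pow] at hC
  -- (6) flat descent to `Γ(X, U)`: the blow-up of `U` at `x` is regular
  have h𝔚 : (IsLocalRing.maximalIdeal (Localization.AtPrime 𝔔.asIdeal)).comap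
      (algebraMap Γ(X, U) (Localization.AtPrime 𝔔.asIdeal)) = 𝔭.asIdeal := by
    have h1 : (IsLocalRing.maximalIdeal (Localization.AtPrime 𝔔.asIdeal)).comap
        (algebraMap Γ(Y, V) (Localization.AtPrime 𝔔.asIdeal)) = 𝔔.asIdeal :=
      Localization.AtPrime.under_maximalIdeal
    rw [IsScalarTower.algebraMap_eq Γ(X, U) Γ(Y, V) (Localization.AtPrime 𝔔.asIdeal), ← Ideal.comap_comap, h1,
      hcomap]
  haveI : IsNoetherianRing Γ(X, U) := Algebra.FiniteType.isNoetherianRing k _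
  have hB : Scheme.IsRegular (affineBlowup (𝔭.asIdeal ^ (a + 1))) :=
    BlowupRegularFlatChart.isRegular_affineBlowup_of_flat_chart 𝔭.asIdeal (𝔭.asIdeal ^ (a + 1)) (n := a + 1)
      le_rfl (Ideal.pow_le_self (Nat.succ_ne_zero a)) hregB _ h𝔚 hC
  -- (7) transfer (chart `C = Γ(X, U)` itself)
  have hsingB : (⟨𝔭.asIdeal, h𝔭max.isPrime⟩ : Spec Γ(X, U)) ∉ Scheme.regularLocus (Spec Γ(X, U)) := by
    intro h𝔭reg
    have h' := (mem_regularLocus_iff_of_flat_of_isPreimmersion ι _).mp h𝔭reg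
    change ι 𝔭 ∈ _ at h'
    rw [hι𝔭] at h'
    exact hx h'
  have h𝔭C : (⟨𝔭.asIdeal, h𝔭max.isPrime⟩ : PrimeSpectrum Γ(X, U)) ∈
      Set.range (PrimeSpectrum.comap (algebraMap Γ(X, U) Γ(X, U))) :=
    ⟨⟨𝔭.asIdeal, h𝔭max.isPrime⟩, by rw [Algebra.algebraMap_self, PrimeSpectrum.comap_id]⟩
  have hI0 : 𝔭.asIdeal ^ (a + 1) ≠ ⊥ := pow_ne_zero _ h𝔭0
  have hregC : Scheme.IsRegular (affineBlowup ((𝔭.asIdeal ^ (a + 1)).map (algebraMap Γ(X, U) Γ(X, U)))) := by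
    rwa [Algebra.algebraMap_self, Ideal.map_id]
  obtain ⟨W, hxW, huniq, Z, ρ, hρ, hZ, hiso, hdense⟩ :=
    ChartHloc.hloc_of_flat_chart k X f ι hιf 𝔭.asIdeal (𝔭.asIdeal ^ (a + 1)) (IsNoetherian.noetherian _) hI0
      (n := a + 1) le_rfl (Ideal.pow_le_self (Nat.succ_ne_zero a)) h𝔭C hregC hsingB hregB
  have hpt : ι ⟨𝔭.asIdeal, h𝔭max.isPrime⟩ = x := hι𝔭
  rw [hpt] at hxW huniq
  exact ⟨W, hxW, huniq, Z, ρ, hρ, hZ, hiso, hdense⟩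


/-- **Resolution when every singular point is étale-locally resolved by blowing up a power of the maximal ideal of the stalk.**
[cite: Kollar2007, §2.2] -/
theorem hasResolution_of_isolated_etale_stalkBlowup_pow (k : Type) [Field k] (X : Scheme.{0}) [IsIntegral X]
    (f : X ⟶ Spec (.of k)) [LocallyOfFiniteType f] (hfin : (Scheme.regularLocus X)ᶜ.Finite)
    (hchart : ∀ x : X, x ∉ Scheme.regularLocus X →
      ∃ (Y : Scheme.{0}) (φ : Y ⟶ X) (_ : Etale φ) (y : Y) (a : ℕ), φ y = x ∧
        Scheme.IsRegular (affineBlowup ((IsLocalRing.maximalIdeal (Y.presheaf.stalk y)) ^ (a + 1)))) :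
    Scheme.HasResolution X := by
  refine IsolatedGlue.hasResolution_of_finite_singularLocus_of_local k X f hfin fun s hs => ?_
  obtain ⟨Y, φ, _, y, a, hys, hbl⟩ := hchart s hs
  subst hys
  exact hloc_of_etale_chart_stalkBlowup_pow k X f hfin φ y hs a hbl

end Summit.ResolutionOfSingularities.ResolutionOfSingularities.Theorems.FRationalResolution.EtaleChartStalkBlowupPow

end
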